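import Literature.NumberTheory.LFunctions.VanDerCorputZeta
import Literature.NumberTheory.LFunctions.ApproxFunctionalEquation
import HarnessLib

/-!
# Ford's bound for `ζ(s)`: the tail `ζ(s) − ∑_{n ≤ t} n^{−s}` (Ford 2002, Lemma 7.2)

Topic `Literature/NumberTheory/LFunctions`. Part of the PROVED deduction "Theorem 2 ⟹ Theorem 1"
of K. Ford, *Vinogradov's integral and bounds for the Riemann zeta function*, Proc. London Math.
Soc. (3) 85 (2002), 565–633 (arXiv:1910.08209) for the named fact
`Literature.NumberTheory.LFunctions.zeta_bound_ford` (`VinogradovKorobov.lean`); see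
`FordZetaBoundMain.lean` for the architecture. Everything here is proved; no definitions.

Lemma 7.2 of the source: for `15/16 ≤ σ ≤ 1`, `t ≥ 10^{100}`,
`|ζ(s, u) − ∑_{0 ≤ n ≤ t} (n+u)^{−s}| ≤ 10^{−80}` (Euler–Maclaurin at `N = ⌊t⌋`, the Fourier
series of the sawtooth function and a first-derivative bound for `∫_t^{t²}`). The in-tree
deduction only needs the error to be `≤ 1`, and we obtain it (for `u = 1`, i.e. for `ζ` itself,
and `t ≥ e^{300}`) by a different standard route through results already in the tree:

* `FordVK.kl_block_far` — a Kusmin–Landau block beyond the height: for `1 ≤ u < m ≤ M`,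
  `‖∑_{m ≤ n ≤ M} n^{−iu}‖ ≤ 4πM/u` (the tree's `VdC.kusminLandau`, Graham–Kolesnik Thm 2.1,
  with `δ = u/(2πM)`; the tree's `VdC.kl_block` is the case `M ≤ 6u`);
* `FordVK.norm_tail_block_le` — with the Abel bound `VdC.abel_bound_rpow`:
  `‖∑_{M < n ≤ x} n^{−s}‖ ≤ 8π M^{1−σ}/t` for `t < M + 1`, `x ≤ 2M`;
* `FordVK.norm_zeta_sub_sum_le_one` — **`‖ζ(s) − ∑_{n ≤ ⌊t⌋} n^{−s}‖ ≤ 1`** for `15/16 ≤ σ ≤ 1`,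
  `t ≥ e^{300}`: Euler–Maclaurin of order `0` ((4.11.2), `AFE.norm_zeta_sub_sum_add_le`) at
  `U = ⌊t⌋ · 2^{I}`, `I = log₂⌊t⌋ + 1` (`t²/2 ≤ U ≤ 2t²`), whose error is `O(t^{−7/8})`, and
  the dyadic blocks of `∑_{⌊t⌋ < n ≤ U} n^{−s}` (`VdC.dyadic_bound`), each `O(t^{−13/16})`,
  `I = O(log t)` of them; everything is bounded by `304 t^{−1/4} ≤ 1`.

## References

* K. Ford, Proc. London Math. Soc. (3) 85 (2002), 565–633; arXiv:1910.08209 — Lemma 7.2.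
  (`Ford2002`)
* S. W. Graham, G. Kolesnik, *Van der Corput's Method of Exponential Sums*, LMS Lecture Notes 126
  (1991), Thm 2.1 (via `VanDerCorputZeta.lean`).
* E. C. Titchmarsh, *The Theory of the Riemann Zeta-Function*, 2nd ed., (4.11.2) (via
  `ApproxFunctionalEquation.lean`).
-/

noncomputable section

open Complex Real Finset

namespace Literature.NumberTheory.LFunctions

namespace FordVK

/-! ## A Kusmin–Landau block beyond the height -/

/-- **Kusmin–Landau block for `n^{−iu}` beyond the height**: for `1 ≤ u < m ≤ M`,
`‖∑_{m ≤ n ≤ M} n^{−iu}‖ ≤ 4πM/u` (in the `e(D₀ n)` normalisation of `VanDerCorputZeta.lean`).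
The increments of the phase `−(u/2π) log n` lie in `[−1/(2π), −u/(2πM)]`, so Kusmin–Landau
applies with `ν = −1`, `δ = u/(2πM)`. [cite: GrahamKolesnik1991, Theorem 2.1] -/
theorem kl_block_far {u : ℝ} (hu : 1 ≤ u) {m M : ℕ} (hm : u < m) (hmM : m ≤ M) :
    ‖∑ n ∈ Finset.Icc (m : ℤ) M, VdC.e (VdC.phaseD u 0 n)‖ ≤ 4 * π * M / u := by
  have hπ : 3 < π := Real.pi_gt_three
  have hu0 : 0 < u := by linarith
  have hM0 : (0 : ℝ) < M := by
    have : (m : ℝ) ≤ M := by exact_mod_cast hmM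
    linarith
  have hMu : u ≤ M := by
    have : (m : ℝ) ≤ M := by exact_mod_cast hmM
    linarith
  set δ : ℝ := u / (2 * π * M) with hδdef
  have hδ : 0 < δ := by rw [hδdef]; positivity
  have hδ2 : δ ≤ 1 / 2 := by
    rw [hδdef, div_le_div_iff₀ (by positivity) (by norm_num)]; nlinarith
  have key := VdC.kusminLandau (φ := fun n : ℤ => VdC.phaseD u 0 n) (m := m) (M := M) (ν := -1)
    hδ hδ2 ?_ ?_
  · calc ‖∑ n ∈ Finset.Icc (m : ℤ) M, VdC.e (VdC.phaseD u 0 n)‖ ≤ 2 / δ := key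
      _ = 4 * π * M / u := by rw [hδdef]; field_simp; ring
  · -- increments in [-1 + δ, -δ]
    intro n h1 h2
    have hmn : (m : ℝ) ≤ n := by exact_mod_cast h1
    have hn0 : (0 : ℝ) < n := by linarith
    have hnu : u < n := by linarith
    have hn1M : (n : ℝ) + 1 ≤ M := by
      have : n + 1 ≤ (M : ℤ) := h2
      have : ((n : ℤ) : ℝ) + 1 ≤ ((M : ℤ) : ℝ) := by exact_mod_cast this
      push_cast at this; linarith
    have hlog_up : Real.log (((n : ℝ) + 1) / n) ≤ 1 / n := by
      have := Real.log_le_sub_one_of_pos (by positivity : (0 : ℝ) < ((n : ℝ) + 1) / n)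
      rwa [show ((n : ℝ) + 1) / n - 1 = 1 / n by field_simp; ring] at this
    have hlog_low : 1 / ((n : ℝ) + 1) ≤ Real.log (((n : ℝ) + 1) / n) := by
      have := Real.one_sub_inv_le_log_of_pos (by positivity : (0 : ℝ) < ((n : ℝ) + 1) / n)
      rwa [show 1 - (((n : ℝ) + 1) / n)⁻¹ = 1 / ((n : ℝ) + 1) by field_simp; ring] at this
    have hθ : VdC.phaseD u 0 ((n + 1 : ℤ) : ℝ) - VdC.phaseD u 0 n
        = -(u / (2 * π)) * Real.log (((n : ℝ) + 1) / n) := by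
      rw [VdC.phaseD_zero, VdC.phaseD_zero, Real.log_div (by positivity) hn0.ne']
      push_cast; ring
    rw [hθ]
    have hc : 0 < u / (2 * π) := by positivity
    constructor
    · -- `-1 + δ ≤ -(u/2π) log(1 + 1/n)`, from `log ≤ 1/n < 1/u` and `δ ≤ 1/2`
      have h3 : u / (2 * π) * Real.log (((n : ℝ) + 1) / n) ≤ 1 / (2 * π) := by
        calc u / (2 * π) * Real.log (((n : ℝ) + 1) / n) ≤ u / (2 * π) * (1 / n) :=
              mul_le_mul_of_nonneg_left hlog_up hc.le
          _ ≤ u / (2 * π) * (1 / u) := by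
              apply mul_le_mul_of_nonneg_left _ hc.le
              exact one_div_le_one_div_of_le hu0 hnu.le
          _ = 1 / (2 * π) := by field_simp
      have h4 : (1 : ℝ) / (2 * π) ≤ 1 / 2 := by
        rw [div_le_div_iff₀ (by positivity) (by norm_num)]; nlinarith
      push_cast
      linarith
    · -- `-(u/2π) log(1+1/n) ≤ -δ`, from `log ≥ 1/(n+1) ≥ 1/M`
      have h3 : δ ≤ u / (2 * π) * Real.log (((n : ℝ) + 1) / n) := by
        calc δ = u / (2 * π) * (1 / M) := by rw [hδdef]; field_simp
          _ ≤ u / (2 * π) * (1 / ((n : ℝ) + 1)) := by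
              apply mul_le_mul_of_nonneg_left _ hc.le
              exact one_div_le_one_div_of_le (by positivity) hn1M
          _ ≤ u / (2 * π) * Real.log (((n : ℝ) + 1) / n) :=
              mul_le_mul_of_nonneg_left hlog_low hc.le
      push_cast
      linarith
  · -- monotonicity of increments (concavity of log)
    intro n h1 _
    have hmn : (m : ℝ) ≤ n := by exact_mod_cast h1
    have hn0 : (0 : ℝ) < n := by linarith
    have hc : 0 < u / (2 * π) := by positivity
    simp only [VdC.phaseD_zero]
    push_cast
    have hlog : Real.log ((n : ℝ) + 2) + Real.log n ≤ 2 * Real.log ((n : ℝ) + 1) := by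
      rw [← Real.log_mul (by positivity) hn0.ne', ← Real.log_rpow (by positivity),
        Real.rpow_two]
      exact Real.log_le_log (by positivity) (by nlinarith)
    nlinarith [hlog, hc]

/-- **A dyadic block beyond the height.** For `σ ≥ 0`, `1 ≤ t < M + 1` and `M ≤ x ≤ 2M`,
`‖∑_{M < n ≤ x} n^{−σ−it}‖ ≤ 8π M^{1−σ}/t` (Abel summation `VdC.abel_bound_rpow` on
`FordVK.kl_block_far`). [folklore] -/
theorem norm_tail_block_le {σ t : ℝ} (hσ : 0 ≤ σ) (ht : 1 ≤ t) {M x : ℕ}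
    (hM : t < (M : ℝ) + 1) (hMx : M ≤ x) (hx2 : x ≤ 2 * M) :
    ‖∑ n ∈ Finset.Ioc M x, (n : ℂ) ^ (-((σ : ℂ) + t * I))‖
      ≤ 8 * π * (M : ℝ) ^ (1 - σ) / t := by
  have ht0 : 0 < t := by linarith
  have hM1 : 1 ≤ M := by
    rcases Nat.eq_zero_or_pos M with h | h
    · subst h; simp at hM; linarith
    · exact h
  have hM0 : (0 : ℝ) < M := by exact_mod_cast hM1
  have hconv : ∑ n ∈ Finset.Ioc M x, (n : ℂ) ^ (-((σ : ℂ) + t * I))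
      = ∑ n ∈ Finset.Ioc M x, (((n : ℝ) ^ (-σ) : ℝ) : ℂ) * VdC.e (VdC.phaseD t 0 n) := by
    refine Finset.sum_congr rfl fun n hn => VdC.natCast_cpow_neg_eq σ t ?_
    have := (Finset.mem_Ioc.1 hn).1; omega
  rw [hconv]
  have hB : 0 ≤ 8 * π * M / t := by positivity
  have hpart : ∀ y, M < y → y ≤ x →
      ‖∑ n ∈ Finset.Ioc M y, VdC.e (VdC.phaseD t 0 n)‖ ≤ 8 * π * M / t := by
    intro y hy1 hy2
    have h := kl_block_far ht (m := M + 1) (M := y) (by push_cast; linarith) (by omega)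
    have e1 : ∑ n ∈ Finset.Icc ((M + 1 : ℕ) : ℤ) y, VdC.e (VdC.phaseD t 0 n)
        = ∑ n ∈ Finset.Ioc M y, VdC.e (VdC.phaseD t 0 n) := by
      rw [VdC.sum_Icc_int_eq_nat, Finset.Icc_add_one_left_eq_Ioc]
      rfl
    push_cast at e1 h
    rw [e1] at h
    refine h.trans ?_
    have hy : (y : ℝ) ≤ 2 * M := by exact_mod_cast hy2.trans hx2
    rw [div_le_div_iff_of_pos_right ht0]
    nlinarith [Real.pi_pos]
  have h := VdC.abel_bound_rpow (σ := σ) (fun n : ℕ => VdC.e (VdC.phaseD t 0 n)) hMx hσ hB hpart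
  refine h.trans ?_
  have h1 : ((M : ℝ) + 1) ^ (-σ) ≤ (M : ℝ) ^ (-σ) :=
    Real.rpow_le_rpow_of_nonpos hM0 (by linarith) (by linarith)
  have h2 : (M : ℝ) ^ (-σ) * (8 * π * M / t) = 8 * π * (M : ℝ) ^ (1 - σ) / t := by
    rw [Real.rpow_sub hM0, Real.rpow_one, Real.rpow_neg hM0.le]
    field_simp
  calc ((M : ℝ) + 1) ^ (-σ) * (8 * π * M / t) ≤ (M : ℝ) ^ (-σ) * (8 * π * M / t) :=
        mul_le_mul_of_nonneg_right h1 hB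
    _ = _ := h2

/-! ## The tail `ζ(s) − ∑_{n ≤ ⌊t⌋} n^{−s}` -/

/-- Elementary size facts at heights `t ≥ e^{300}`: `t ≥ 16`, `log t ≤ 4 t^{1/4}` and
`304 t^{−1/4} ≤ 1`. [folklore] -/
theorem height_facts {t : ℝ} (ht : Real.exp 300 ≤ t) :
    16 ≤ t ∧ Real.log t ≤ 4 * t ^ (1 / 4 : ℝ) ∧ 304 * t ^ (-(1 / 4 : ℝ)) ≤ 1 := by
  have h300 : (300 : ℝ) + 1 ≤ Real.exp 300 := Real.add_one_le_exp 300
  have ht16 : 16 ≤ t := by linarith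
  have ht0 : 0 < t := by linarith
  refine ⟨ht16, ?_, ?_⟩
  · have := Real.log_le_rpow_div ht0.le (by norm_num : (0 : ℝ) < 1 / 4)
    linarith
  · -- `t^{1/4} ≥ e^{75} ≥ 304`
    have h1 : Real.exp 75 ≤ t ^ (1 / 4 : ℝ) := by
      have : Real.exp 75 = (Real.exp 300) ^ (1 / 4 : ℝ) := by
        rw [← Real.exp_mul]; norm_num
      rw [this]
      exact Real.rpow_le_rpow (Real.exp_pos _).le ht (by norm_num)
    have h2 : (304 : ℝ) ≤ Real.exp 75 := by
      have := Real.quadratic_le_exp_of_nonneg (by norm_num : (0 : ℝ) ≤ 75); nlinarith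
    have h3 : 0 < t ^ (1 / 4 : ℝ) := by positivity
    rw [Real.rpow_neg ht0.le]
    rw [← div_eq_mul_inv, div_le_one h3]
    linarith

/-- **`‖ζ(s) − ∑_{n ≤ ⌊t⌋} n^{−s}‖ ≤ 1` for `15/16 ≤ σ ≤ 1`, `t ≥ e^{300}`** (the role of Lemma 7.2
of the source in the deduction; here from (4.11.2) at `U = ⌊t⌋ 2^{I}`, `I = log₂⌊t⌋ + 1`, and
Kusmin–Landau on the dyadic blocks of `(⌊t⌋, U]`). [cite: Ford2002, Lemma 7.2] -/
theorem norm_zeta_sub_sum_le_one {σ t : ℝ} (hσ : 15 / 16 ≤ σ) (hσ1 : σ ≤ 1)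
    (ht : Real.exp 300 ≤ t) :
    ‖riemannZeta (σ + t * I) - ∑ n ∈ Finset.Icc 1 ⌊t⌋₊, (n : ℂ) ^ (-((σ : ℂ) + t * I))‖ ≤ 1 := by
  obtain ⟨ht16, hlogt, hsmall⟩ := height_facts ht
  have ht0 : 0 < t := by linarith
  have ht1 : 1 ≤ t := by linarith
  have hσ0 : 0 < σ := by linarith
  set s : ℂ := (σ : ℂ) + t * I with hs
  have hsre : s.re = σ := by simp [hs]
  have hs1 : s ≠ 1 := by
    intro h; have := congrArg Complex.im h; simp [hs] at this; linarith
  -- `N₁ = ⌊t⌋`, `I = log₂ N₁ + 1`, `U = N₁ 2^I`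
  set N₁ : ℕ := ⌊t⌋₊ with hN₁
  have hN₁1 : 1 ≤ N₁ := by rw [hN₁]; exact Nat.le_floor (by exact_mod_cast ht1)
  have hN₁t : (N₁ : ℝ) ≤ t := Nat.floor_le ht0.le
  have htN₁ : t < (N₁ : ℝ) + 1 := Nat.lt_floor_add_one t
  have hN₁0 : (0 : ℝ) < N₁ := by exact_mod_cast hN₁1
  set J : ℕ := Nat.log 2 N₁ with hJ
  set I₂ : ℕ := J + 1 with hI₂
  have h2I : N₁ < 2 ^ I₂ := Nat.lt_pow_succ_log_self one_lt_two N₁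
  have h2I' : 2 ^ J ≤ N₁ := Nat.pow_log_le_self 2 (by omega)
  set U : ℕ := N₁ * 2 ^ I₂ with hU
  have hU1 : 1 ≤ U := by rw [hU]; exact one_le_mul hN₁1 (Nat.one_le_two_pow)
  have hN₁U : N₁ ≤ U := by rw [hU]; exact Nat.le_mul_of_pos_right _ (by positivity)
  -- real-size facts: `t²/2 ≤ U ≤ 2t²`, `I ≤ 3 log t`
  have hUge : t ^ 2 / 2 ≤ (U : ℝ) := by
    have h1 : ((N₁ : ℝ) + 1) ≤ (2 : ℝ) ^ I₂ := by exact_mod_cast h2I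
    have h2 : (N₁ : ℝ) * ((N₁ : ℝ) + 1) ≤ U := by
      rw [hU]; push_cast
      exact mul_le_mul_of_nonneg_left h1 hN₁0.le
    have h3 : (t - 1) * t ≤ (N₁ : ℝ) * ((N₁ : ℝ) + 1) :=
      mul_le_mul (by linarith) (by linarith) (by linarith) (by linarith)
    nlinarith only [h2, h3, ht16]
  have hUle : (U : ℝ) ≤ 2 * t ^ 2 := by
    have h1 : (2 : ℝ) ^ I₂ ≤ 2 * N₁ := by
      have : 2 ^ I₂ ≤ 2 * N₁ := by
        rw [hI₂, pow_succ']; omega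
      exact_mod_cast this
    rw [hU]; push_cast
    calc (N₁ : ℝ) * 2 ^ I₂ ≤ N₁ * (2 * N₁) := mul_le_mul_of_nonneg_left h1 hN₁0.le
      _ ≤ 2 * t ^ 2 := by nlinarith only [hN₁t, hN₁0]
  have hIle : (I₂ : ℝ) ≤ 3 * Real.log t := by
    have h1 : (2 : ℝ) ^ J ≤ t := by
      have : ((2 ^ J : ℕ) : ℝ) ≤ N₁ := by exact_mod_cast h2I'
      push_cast at this; linarith
    have h2 : (J : ℝ) * Real.log 2 ≤ Real.log t := by
      rw [← Real.log_pow]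
      exact Real.log_le_log (by positivity) h1
    have hlog2 : (1 / 2 : ℝ) < Real.log 2 := by linarith [Real.log_two_gt_d9]
    have hL1 : 300 ≤ Real.log t := by
      rw [Real.le_log_iff_exp_le ht0]; exact ht
    have hJ0 : (0 : ℝ) ≤ J := Nat.cast_nonneg J
    have hI : (I₂ : ℝ) = J + 1 := by rw [hI₂]; push_cast; ring
    rw [hI]
    nlinarith only [h2, hlog2, hL1, hJ0]
  -- (4.11.2) at `U`
  have key := AFE.norm_zeta_sub_sum_add_le (s := s) (by rw [hsre]; exact hσ0) hs1 hU1
  rw [hsre] at key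
  -- split the sum at `N₁`
  have hsplit : ∑ n ∈ Finset.Icc 1 U, (n : ℂ) ^ (-s)
      = ∑ n ∈ Finset.Icc 1 N₁, (n : ℂ) ^ (-s) + ∑ n ∈ Finset.Ioc N₁ U, (n : ℂ) ^ (-s) := by
    rw [show Finset.Icc 1 U = Finset.Ioc 0 U from Finset.Icc_add_one_left_eq_Ioc 0 U,
      show Finset.Icc 1 N₁ = Finset.Ioc 0 N₁ from Finset.Icc_add_one_left_eq_Ioc 0 N₁]
    exact (Finset.sum_Ioc_consecutive _ (Nat.zero_le N₁) hN₁U).symm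
  -- the dyadic blocks beyond the height
  have hσ0' : 0 ≤ σ := hσ0.le
  set G : ℝ := 8 * π * (U : ℝ) ^ (1 - σ) / t with hG
  have hG0 : 0 ≤ G := by rw [hG]; positivity
  have hblocks : ‖∑ n ∈ Finset.Ioc N₁ U, (n : ℂ) ^ (-s)‖ ≤ ∑ i ∈ Finset.range I₂, G := by
    have h := VdC.dyadic_bound (fun n : ℕ => (n : ℂ) ^ (-s)) (fun _ => G) (fun _ => hG0) U I₂ N₁
      ?_ (by rw [hU])
    · exact h
    intro i hi
    have hM : t < ((N₁ * 2 ^ i : ℕ) : ℝ) + 1 := by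
      have : (N₁ : ℝ) ≤ ((N₁ * 2 ^ i : ℕ) : ℝ) := by
        exact_mod_cast Nat.le_mul_of_pos_right _ (by positivity)
      linarith
    have hle1 : N₁ * 2 ^ i ≤ N₁ * 2 ^ (i + 1) :=
      Nat.mul_le_mul_left _ (Nat.pow_le_pow_right (by norm_num) (by omega))
    have hle2 : min (N₁ * 2 ^ (i + 1)) U ≤ 2 * (N₁ * 2 ^ i) :=
      (min_le_left _ _).trans (le_of_eq (by ring))
    have h1 := norm_tail_block_le hσ0' ht1 (M := N₁ * 2 ^ i) (x := min (N₁ * 2 ^ (i + 1)) U) hM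
      (le_min hle1 hi.le) hle2
    rw [hs]
    refine h1.trans ?_
    rw [hG]
    have hMU : ((N₁ * 2 ^ i : ℕ) : ℝ) ≤ U := by exact_mod_cast hi.le
    have hM0 : (0 : ℝ) ≤ ((N₁ * 2 ^ i : ℕ) : ℝ) := by positivity
    have : ((N₁ * 2 ^ i : ℕ) : ℝ) ^ (1 - σ) ≤ (U : ℝ) ^ (1 - σ) :=
      Real.rpow_le_rpow hM0 hMU (by linarith)
    exact div_le_div_of_nonneg_right (mul_le_mul_of_nonneg_left this (by positivity)) ht0.le
  rw [Finset.sum_const, Finset.card_range, nsmul_eq_mul] at hblocks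
  -- sizes of the three error terms
  have hU0 : (0 : ℝ) < U := by exact_mod_cast hU1
  have hU1' : (1 : ℝ) ≤ U := by exact_mod_cast hU1
  have hUpow : (U : ℝ) ^ (1 - σ) ≤ t ^ (3 / 16 : ℝ) := by
    calc (U : ℝ) ^ (1 - σ) ≤ (U : ℝ) ^ (1 / 16 : ℝ) :=
          Real.rpow_le_rpow_of_exponent_le hU1' (by linarith)
      _ ≤ (t ^ 3) ^ (1 / 16 : ℝ) := by
          apply Real.rpow_le_rpow hU0.le _ (by norm_num)
          nlinarith only [hUle, ht16]
      _ = t ^ (3 / 16 : ℝ) := by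
          rw [← Real.rpow_natCast, ← Real.rpow_mul ht0.le]; norm_num
  have hUneg : (U : ℝ) ^ (-σ) ≤ t ^ (-(45 / 32) : ℝ) := by
    have h1 : t ^ (3 / 2 : ℝ) ≤ U := by
      have h2 : t ^ (3 / 2 : ℝ) ≤ t ^ 2 / 2 := by
        have h4 : (4 : ℝ) ≤ t ^ (1 / 2 : ℝ) := by
          rw [← Real.sqrt_eq_rpow, Real.le_sqrt (by norm_num) ht0.le]; linarith
        have e : t ^ 2 / 2 = t ^ (3 / 2 : ℝ) * (t ^ (1 / 2 : ℝ) / 2) := by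
          rw [mul_div_assoc', ← Real.rpow_add ht0]; norm_num
        rw [e]
        have h5 : 0 ≤ t ^ (3 / 2 : ℝ) := by positivity
        nlinarith only [h4, h5]
      linarith
    calc (U : ℝ) ^ (-σ) ≤ (U : ℝ) ^ (-(15 / 16) : ℝ) :=
          Real.rpow_le_rpow_of_exponent_le hU1' (by linarith)
      _ ≤ (t ^ (3 / 2 : ℝ)) ^ (-(15 / 16) : ℝ) :=
          Real.rpow_le_rpow_of_nonpos (by positivity) h1 (by norm_num)
      _ = t ^ (-(45 / 32) : ℝ) := by rw [← Real.rpow_mul ht0.le]; norm_num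
  -- everything against `t^{-1/4}`
  have hq0 : 0 < t ^ (-(1 / 4) : ℝ) := by positivity
  have e1 : t ^ (3 / 16 : ℝ) / t = t ^ (-(13 / 16) : ℝ) := by
    rw [div_eq_mul_inv, ← Real.rpow_neg_one, ← Real.rpow_add ht0]; norm_num
  have hA : ‖(U : ℂ) ^ (1 - s) / (1 - s)‖ ≤ t ^ (-(1 / 4) : ℝ) := by
    rw [norm_div, Complex.norm_natCast_cpow_of_pos (by omega : 0 < U)]
    have h1 : (1 - s).re = 1 - σ := by simp [hs]
    rw [h1]
    have h2 : t ≤ ‖1 - s‖ := by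
      have := Complex.abs_im_le_norm (1 - s)
      rw [show (1 - s).im = -t by simp [hs], abs_neg, abs_of_pos ht0] at this
      exact this
    calc (U : ℝ) ^ (1 - σ) / ‖1 - s‖ ≤ (U : ℝ) ^ (1 - σ) / t :=
          div_le_div_of_nonneg_left (by positivity) ht0 h2
      _ ≤ t ^ (3 / 16 : ℝ) / t := div_le_div_of_nonneg_right hUpow ht0.le
      _ = t ^ (-(13 / 16) : ℝ) := e1
      _ ≤ t ^ (-(1 / 4) : ℝ) := Real.rpow_le_rpow_of_exponent_le ht1 (by norm_num)
  have hB : (U : ℝ) ^ (-σ) * (1 / 2 + ‖s‖ / (2 * σ)) ≤ t ^ (-(1 / 4) : ℝ) := by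
    have h1 : ‖s‖ ≤ 1 + t := by
      calc ‖s‖ ≤ ‖(σ : ℂ)‖ + ‖(t : ℂ) * I‖ := norm_add_le _ _
        _ = σ + t := by
            rw [norm_mul, Complex.norm_I, mul_one, Complex.norm_real, Complex.norm_real,
              Real.norm_eq_abs, Real.norm_eq_abs, abs_of_pos hσ0, abs_of_pos ht0]
        _ ≤ 1 + t := by linarith
    have h2 : 1 / 2 + ‖s‖ / (2 * σ) ≤ t := by
      have h3 : ‖s‖ / (2 * σ) ≤ (1 + t) * (8 / 15) := by
        rw [div_le_iff₀ (by positivity)]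
        calc ‖s‖ ≤ (1 + t) * 1 := by linarith
          _ ≤ (1 + t) * (8 / 15 * (2 * σ)) :=
              mul_le_mul_of_nonneg_left (by linarith) (by linarith)
          _ = (1 + t) * (8 / 15) * (2 * σ) := by ring
      linarith
    calc (U : ℝ) ^ (-σ) * (1 / 2 + ‖s‖ / (2 * σ)) ≤ t ^ (-(45 / 32) : ℝ) * t :=
          mul_le_mul hUneg h2 (by positivity) (by positivity)
      _ = t ^ (-(13 / 32) : ℝ) := by
          rw [← Real.rpow_add_one ht0.ne']; norm_num
      _ ≤ t ^ (-(1 / 4) : ℝ) := Real.rpow_le_rpow_of_exponent_le ht1 (by norm_num)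
  have hC : (I₂ : ℝ) * G ≤ 96 * π * t ^ (-(1 / 4) : ℝ) := by
    have h1 : G ≤ 8 * π * t ^ (-(13 / 16) : ℝ) := by
      rw [hG, ← e1, mul_div_assoc]
      exact mul_le_mul_of_nonneg_left (div_le_div_of_nonneg_right hUpow ht0.le) (by positivity)
    have h2 : (I₂ : ℝ) ≤ 12 * t ^ (1 / 4 : ℝ) := hIle.trans (by linarith)
    have h3 : t ^ (1 / 4 : ℝ) * t ^ (-(13 / 16) : ℝ) ≤ t ^ (-(1 / 4) : ℝ) := by
      rw [← Real.rpow_add ht0]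
      exact Real.rpow_le_rpow_of_exponent_le ht1 (by norm_num)
    calc (I₂ : ℝ) * G ≤ (12 * t ^ (1 / 4 : ℝ)) * (8 * π * t ^ (-(13 / 16) : ℝ)) :=
          mul_le_mul h2 h1 hG0 (by positivity)
      _ = 96 * π * (t ^ (1 / 4 : ℝ) * t ^ (-(13 / 16) : ℝ)) := by ring
      _ ≤ 96 * π * t ^ (-(1 / 4) : ℝ) := mul_le_mul_of_nonneg_left h3 (by positivity)
  -- assemble
  set Z := riemannZeta s with hZ
  set S₁ := ∑ n ∈ Finset.Icc 1 N₁, (n : ℂ) ^ (-s) with hS₁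
  set S₂ := ∑ n ∈ Finset.Ioc N₁ U, (n : ℂ) ^ (-s) with hS₂
  set T := (U : ℂ) ^ (1 - s) / (1 - s) with hT
  rw [hsplit] at key
  have htri : ‖Z - S₁‖ ≤ ‖Z - (S₁ + S₂) + T‖ + ‖S₂‖ + ‖T‖ := by
    have e : Z - S₁ = (Z - (S₁ + S₂) + T) + (S₂ - T) := by ring
    calc ‖Z - S₁‖ = ‖(Z - (S₁ + S₂) + T) + (S₂ - T)‖ := by rw [← e]
      _ ≤ ‖Z - (S₁ + S₂) + T‖ + ‖S₂ - T‖ := norm_add_le _ _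
      _ ≤ ‖Z - (S₁ + S₂) + T‖ + (‖S₂‖ + ‖T‖) := by gcongr; exact norm_sub_le _ _
      _ = _ := by ring
  have hπ4 : π < 3.1416 := Real.pi_lt_d4
  have hπq : π * t ^ (-(1 / 4) : ℝ) ≤ 3.1416 * t ^ (-(1 / 4) : ℝ) :=
    mul_le_mul_of_nonneg_right hπ4.le hq0.le
  have h1 : ‖S₂‖ ≤ 96 * π * t ^ (-(1 / 4) : ℝ) := hblocks.trans hC
  have h2 : ‖Z - (S₁ + S₂) + T‖ ≤ t ^ (-(1 / 4) : ℝ) := key.trans hB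
  have h3 : ‖Z - S₁‖ ≤ 2 * t ^ (-(1 / 4) : ℝ) + 96 * (π * t ^ (-(1 / 4) : ℝ)) := by
    have := hA; linarith
  linarith

end FordVK

end Literature.NumberTheory.LFunctions
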